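import Mathlib
import Summits.NavierStokesRegularity.NavierStokesRegularity.Theorems.DssFarFieldSlavingBlowupTypeIDssProfileCorotatingProfileHypotheses
import Summits.NavierStokesRegularity.NavierStokesRegularity.Theorems.DssFarFieldSlavingBlowupTypeIDssProfileGaussianSignCoherentMean
import HarnessLib

/-!
# E33 (pointwise and period-mean forms) for Type-I rotated-DSS fields — CLASSICAL level, similarity
  variables (pub-ns-dss theory T42 / row E33, E33-CLASS-BRIDGE v1.2 (C2)–(C4), NULL-TESTS n21
  (E33-MEAN); route `DssFarFieldSlaving`, crux `BlowupTypeIDssProfile`, stmt-NavierStokesRegularity-0155 —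
  SUPPORT; cell pub-ns-dss, typer seat g5, 2026-08-23; imports the hypothesis package
  `…CorotatingProfileHypotheses.lean` and the profile lemmas `…GaussianSignCoherentSlice.lean` /
  `…GaussianSignCoherentMean.lean`; the CLASS wrappers are the next file `…GaussianSignCoherentClass.lean`)

HONEST FRAMING. Liouville statements for Type-I ancient mild fields in the KNSS gauge with the
space–time Type-I bound and a rotated `c`-DSS structure (Pineau–Vicol twist convention
`IsRotatedDSS c (rotZLIE (−θ)) V`), cut by a SIGN CONDITION on the co-rotating similarity profile — the
CLASSICAL-level forms of the census cell E33 (pointwise) and of its operational period-mean form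
E33-MEAN; the class-level forms (SLICES of the hypothesis class of
`Theses.FilamentSkeletonRss.RdssProfileTruncation`) are the next file. An empty cell is a census ghost
index (C13 D-6), never a discard; nothing here bears on Navier–Stokes regularity or blow-up. Nothing is
numeric.

THE CELL. `α = θ / (2 log c)`, `U(y, s) = R_{−αs} (lerayOrbit V s)(R_{αs} y)` (`R_θ = rotZ θ`),
`P(y, s) = e^{−s} Q[V(−e^{−s})](e^{−s/2} R_{αs} y)`, `Q = pressurePotential` the normalised
(Calderón–Zygmund) pressure of the slice in its decay normalisation (Tao 2011 (35); equivalently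
`P(y, s) = Q[lerayOrbit V s](R_{αs} y)`, `GaussianHeadPressure.exp_mul_pressurePotential_eq`).
POINTWISE form: `0 ≤ ⟪y, U(y,s)⟫ (½|U(y,s)|² + P(y,s))` for all `y, s`. PERIOD-MEAN form:
`0 ≤ ∫₀^{2 log c} ∫ γ(y) ⟪y, U⟫ (½|U|² + P + ½⟪y, U⟫) dy ds`, `γ(y) = e^{−|y|²/4}` (implied by the
pointwise form, since `⟪y,U⟫(½|U|² + P + ½⟪y,U⟫) = ⟪y,U⟫(½|U|² + P) + ½⟪y,U⟫²`). THE GAUGE IS NAMED: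
both hypotheses are stated for THIS `P`. The POINTWISE one is NOT invariant under `P ↦ P + c(s)` (shift
by `c(s)⟪y, U⟫`, of no sign); the class fixes the gauge because every classical pressure of the field has
the spatial gradient of `Q[V(t)]` (`pressure_eq_pressurePotential_add_of_hasTypeIDecay`, Tao 2011
Lemma 4.1). The PERIOD-MEAN one IS gauge invariant: `yγ = −2∇γ`, so `∫γ⟪y,U⟫ = 2∫γ div U = 0` on every
divergence-free decaying slice and a per-slice pressure constant drops out (cell red-team remark) — the
census test n21 is gauge-free.

THE THEOREMS: `typeI_rdss_signCoherent_eq_zero` (pointwise) and `typeI_rdss_meanSignCoherent_eq_zero`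
(period mean): `V ≡ 0` on `t < 0`. PROOF: the hypothesis package
`typeI_rdss_corotatingProfile_hypotheses` + the landed profile lemmas
(`signCoherent_rdssProfile_trivial_slicePressure`, `meanSignCoherent_rdssProfile_trivial_slicePressure`,
degree `N = 1`) ⇒ `U ≡ 0` ⇒ `V ≡ 0` on the past.
[this file; theory T42/E33 + E33-CLASS-BRIDGE v1.2 (C2)–(C4), NULL-TESTS n21]
-/

noncomputable section

set_option linter.dupNamespace false

namespace Summit.NavierStokesRegularity.NavierStokesRegularity.Theorems.GaussianHeadPressure

open Set Function Filter MeasureTheory InnerProductSpace Metric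
open scoped RealInnerProductSpace Laplacian ContDiff Topology BigOperators
open Literature.Analysis Literature.Analysis.FluidPDE Literature.Analysis.FluidPDE.PineauVicol2026
open Summit.NavierStokesRegularity.NavierStokesRegularity.Theorems

/-! ### The classical-level theorems -/

/-- **E33 (pointwise form) at CLASSICAL level, similarity variables.** Let `V` be a Type-I ancient mild
field in the KNSS gauge (`IsTypeIAncientMild M V`) with the space–time Type-I bound `HasTypeIDecay M V`,
rotated `c`-DSS with twist `R_{−θ}` (`IsRotatedDSS c (rotZLIE (−θ)) V`, `1 < c`); put `α = θ/(2 log c)`,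
`U(y,s) = R_{−αs}(lerayOrbit V s)(R_{αs} y)` (co-rotating similarity profile) and
`P(y,s) = e^{−s} Q[V(−e^{−s})](e^{−s/2} R_{αs} y)` (transported Calderón–Zygmund pressure,
`Q = pressurePotential`). If `0 ≤ ⟪y, U(y,s)⟫ (½|U(y,s)|² + P(y,s))` for all `s, y` (POINTWISE sign
condition, stated with THIS gauge), then `V ≡ 0` on `t < 0`. Proof: the hypothesis package and the
landed profile lemma `signCoherent_rdssProfile_trivial_slicePressure`.
[this file; theory T42/E33 + E33-CLASS-BRIDGE v1.2 (C2)–(C4), classical level] -/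
theorem typeI_rdss_signCoherent_eq_zero {M c θ : ℝ}
    {V : ℝ → EuclideanSpace ℝ (Fin 3) → EuclideanSpace ℝ (Fin 3)} (hc : 1 < c)
    (hT : IsTypeIAncientMild M V) (hR : IsRotatedDSS c (rotZLIE (-θ)) V) (hVdec : HasTypeIDecay M V)
    (hsV : ∀ (s : ℝ) (y : EuclideanSpace ℝ (Fin 3)),
        0 ≤ ⟪y, rotZ (-(θ / (2 * Real.log c) * s))
              (lerayOrbit V s (rotZ (θ / (2 * Real.log c) * s) y))⟫ *
          (2⁻¹ * ‖rotZ (-(θ / (2 * Real.log c) * s))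
              (lerayOrbit V s (rotZ (θ / (2 * Real.log c) * s) y))‖ ^ 2 +
            Real.exp (-s) * pressurePotential (V (-Real.exp (-s)))
              (Real.exp (-s / 2) • rotZ (θ / (2 * Real.log c) * s) y))) :
    ∀ t < 0, ∀ x, V t x = 0 := by
  have hS : 0 < 2 * Real.log c := by have := Real.log_pos hc; positivity
  -- opaque names for the profile and the pressure
  obtain ⟨U, hU_def⟩ : ∃ U : EuclideanSpace ℝ (Fin 3) → ℝ → EuclideanSpace ℝ (Fin 3),
      U = fun y s => rotZ (-(θ / (2 * Real.log c) * s))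
        (lerayOrbit V s (rotZ (θ / (2 * Real.log c) * s) y)) := ⟨_, rfl⟩
  obtain ⟨P, hP_def⟩ : ∃ P : EuclideanSpace ℝ (Fin 3) → ℝ → ℝ, P = fun y s =>
      Real.exp (-s) * pressurePotential (V (-Real.exp (-s)))
        (Real.exp (-s / 2) • rotZ (θ / (2 * Real.log c) * s) y) := ⟨_, rfl⟩
  have hUys : ∀ y s, U y s = rotZ (-(θ / (2 * Real.log c) * s))
      (lerayOrbit V s (rotZ (θ / (2 * Real.log c) * s) y)) := fun y s => by rw [hU_def]
  have hPys : ∀ y s, P y s = Real.exp (-s) * pressurePotential (V (-Real.exp (-s)))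
      (Real.exp (-s / 2) • rotZ (θ / (2 * Real.log c) * s) y) := fun y s => by rw [hP_def]
  obtain ⟨hUj, hPsl, hperU, heq, hdiv, hΔP, hW, C, hUb, hDUb, hPb, hUsb, hgPb⟩ :=
    typeI_rdss_corotatingProfile_hypotheses hc hT hR hVdec hUys hPys
  have hsU : ∀ s y, 0 ≤ ⟪y, U y s⟫ * (2⁻¹ * ‖U y s‖ ^ 2 + P y s) := fun s y => by
    rw [hUys, hPys]; exact hsV s y
  have hU0 : ∀ y s, U y s = 0 :=
    signCoherent_rdssProfile_trivial_slicePressure (N := 1) hS hUj hPsl hperU heq hdiv hΔP hUb hDUb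
      hPb hUsb hgPb hsU
  intro t ht x
  rw [eq_lerayOrbit_of_neg V ht x, hW, hU0, ← rotZL_apply, map_zero, smul_zero]

/-- **E33 in PERIOD-MEAN form (E33-MEAN, NULL-TESTS n21) at CLASSICAL level, similarity variables.**
Same setting as `typeI_rdss_signCoherent_eq_zero`; the pointwise sign condition is replaced by the single
inequality `0 ≤ ∫₀^{2 log c} ∫ γ(y) ⟪y, U(y,s)⟫ (½|U(y,s)|² + P(y,s) + ½⟪y, U(y,s)⟫) dy ds`
(`γ(y) = e^{−|y|²/4}` = `gaussWeight`; the integrand is `⟪y,U⟫ · headPressure ½`), the period mean of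
the Gaussian radial-flux pairing — the census's operational ghost criterion (an integral with a sign is
what a certified numerical row can instantiate). Then `V ≡ 0` on `t < 0`. Proof: the hypothesis package
and the profile lemma `meanSignCoherent_rdssProfile_trivial_slicePressure`.
[this file; theory T42/E33, NULL-TESTS n21 (E33-MEAN, DERIVED ×2); typer] -/
theorem typeI_rdss_meanSignCoherent_eq_zero {M c θ : ℝ}
    {V : ℝ → EuclideanSpace ℝ (Fin 3) → EuclideanSpace ℝ (Fin 3)} (hc : 1 < c)
    (hT : IsTypeIAncientMild M V) (hR : IsRotatedDSS c (rotZLIE (-θ)) V) (hVdec : HasTypeIDecay M V)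
    (hmV : 0 ≤ ∫ s in (0 : ℝ)..(2 * Real.log c), ∫ y : EuclideanSpace ℝ (Fin 3), gaussWeight y *
        (⟪y, rotZ (-(θ / (2 * Real.log c) * s))
              (lerayOrbit V s (rotZ (θ / (2 * Real.log c) * s) y))⟫ *
          (2⁻¹ * ‖rotZ (-(θ / (2 * Real.log c) * s))
              (lerayOrbit V s (rotZ (θ / (2 * Real.log c) * s) y))‖ ^ 2 +
            Real.exp (-s) * pressurePotential (V (-Real.exp (-s)))
              (Real.exp (-s / 2) • rotZ (θ / (2 * Real.log c) * s) y) +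
            1 / 2 * ⟪y, rotZ (-(θ / (2 * Real.log c) * s))
              (lerayOrbit V s (rotZ (θ / (2 * Real.log c) * s) y))⟫))) :
    ∀ t < 0, ∀ x, V t x = 0 := by
  have hS : 0 < 2 * Real.log c := by have := Real.log_pos hc; positivity
  obtain ⟨U, hU_def⟩ : ∃ U : EuclideanSpace ℝ (Fin 3) → ℝ → EuclideanSpace ℝ (Fin 3),
      U = fun y s => rotZ (-(θ / (2 * Real.log c) * s))
        (lerayOrbit V s (rotZ (θ / (2 * Real.log c) * s) y)) := ⟨_, rfl⟩
  obtain ⟨P, hP_def⟩ : ∃ P : EuclideanSpace ℝ (Fin 3) → ℝ → ℝ, P = fun y s =>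
      Real.exp (-s) * pressurePotential (V (-Real.exp (-s)))
        (Real.exp (-s / 2) • rotZ (θ / (2 * Real.log c) * s) y) := ⟨_, rfl⟩
  have hUys : ∀ y s, U y s = rotZ (-(θ / (2 * Real.log c) * s))
      (lerayOrbit V s (rotZ (θ / (2 * Real.log c) * s) y)) := fun y s => by rw [hU_def]
  have hPys : ∀ y s, P y s = Real.exp (-s) * pressurePotential (V (-Real.exp (-s)))
      (Real.exp (-s / 2) • rotZ (θ / (2 * Real.log c) * s) y) := fun y s => by rw [hP_def]
  obtain ⟨hUj, hPsl, hperU, heq, hdiv, hΔP, hW, C, hUb, hDUb, hPb, hUsb, hgPb⟩ :=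
    typeI_rdss_corotatingProfile_hypotheses hc hT hR hVdec hUys hPys
  have hmU : 0 ≤ ∫ s in (0 : ℝ)..(2 * Real.log c), ∫ y, gaussWeight y *
      (⟪y, U y s⟫ * headPressure (1 / 2) (fun z => U z s) (fun z => P z s) y) := by
    have e : (fun s => ∫ y, gaussWeight y *
        (⟪y, U y s⟫ * headPressure (1 / 2) (fun z => U z s) (fun z => P z s) y)) = fun s =>
        ∫ y : EuclideanSpace ℝ (Fin 3), gaussWeight y *
          (⟪y, rotZ (-(θ / (2 * Real.log c) * s))
                (lerayOrbit V s (rotZ (θ / (2 * Real.log c) * s) y))⟫ *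
            (2⁻¹ * ‖rotZ (-(θ / (2 * Real.log c) * s))
                (lerayOrbit V s (rotZ (θ / (2 * Real.log c) * s) y))‖ ^ 2 +
              Real.exp (-s) * pressurePotential (V (-Real.exp (-s)))
                (Real.exp (-s / 2) • rotZ (θ / (2 * Real.log c) * s) y) +
              1 / 2 * ⟪y, rotZ (-(θ / (2 * Real.log c) * s))
                (lerayOrbit V s (rotZ (θ / (2 * Real.log c) * s) y))⟫)) := by
      funext s
      simp only [headPressure_apply, hU_def, hP_def]
    rw [e]
    exact hmV
  have hU0 : ∀ y s, U y s = 0 :=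
    meanSignCoherent_rdssProfile_trivial_slicePressure (N := 1) hS hUj hPsl hperU heq hdiv hΔP hUb hDUb
      hPb hUsb hgPb hmU
  intro t ht x
  rw [eq_lerayOrbit_of_neg V ht x, hW, hU0, ← rotZL_apply, map_zero, smul_zero]


end Summit.NavierStokesRegularity.NavierStokesRegularity.Theorems.GaussianHeadPressure

end
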